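import Summits.NavierStokesRegularity.FluidComputer.GateBudgetCombSharp
import Summits.NavierStokesRegularity.FluidComputer.GateBudgetCombProfile
import HarnessLib

/-!
# What no tuning can beat, part 25b: THE PROFILE OF THE COMB TO SECOND ORDER — one theorem of
# which the duds of parts 20/21, the teeth of parts 22/23 and the profile of part 24 are cases

Cell `pub-fluidc`, blueprint seat bp1 (gen 30, fourth item, second half); same namespace and
conventions as parts 1–25a (`GateBudget*.lean`); imports part 25a (`GateBudgetCombSharp`: the
second-order exit, the cap and the floor behind a pin) and part 24b (`GateBudgetCombProfile`:
the window numerics `profile_delta`, and through it parts 19–23). Modes `0 = a` input,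
`1 = b` clock, `2 = c` catalyst, `3 = d` transfer, `4 = ã` output; `σ_knob = ρ²/ε`.
HONEST FRAMING (verbatim): low prior, high value-of-information experiment on Tao's machine
paradigm; NOT a claim that NS blows up.

THE POINT. §75 (`knob_member_profile_sharp`): along ANY member, `ε = wMρ²`, under part 19's
polynomial trigger hypotheses, at the member's own dousing time `T`,
`|cos wπ|(1 - ψ²/2) - |sin wπ|ψ - D ≤ |a(T)| ≤ |cos wπ| + |sin wπ|ψ + D` and
`|sin wπ|(1 - ψ²/2) - |cos wπ|ψ - D ≤ |d(T)| ≤ |sin wπ| + |cos wπ|ψ + D`; behind any pin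
`0 ≤ L ≤ |cos wπ|(1 - ψ²/2) - |sin wπ|ψ - D` the output is CAPPED, `ã² ≤ 1 - L² + A` on
`[0, T + 1/8]`, and behind any pin `0 ≤ L ≤ |sin wπ|(1 - ψ²/2) - |cos wπ|ψ - D` it FIRES,
`ã ≥ θ` from `T + 1/8` on whenever `θ ≤ (K/8)(L² - A′ - θ²)` — part 25a's exit, cap and floor
with every level discharged by part 19 (`knob_dynamic_levels`) and the closed forms of parts
20/22b. §76 puts in the numbers at Tao's amplifier `M = K¹⁰` on the window
`200ε/K²⁰ ≤ ρ² ≤ 2ε/K¹⁰` (`ψ = 7/100`, `D = 10⁻³`, `A, A′ ≤ 10⁻³`, `1 - ψ²/2 = 19951/20000`):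
`|a(T)| = |cos wπ| (+ 0.07|sin wπ| + 10⁻³ / × 0.99755 - 0.07|sin wπ| - 10⁻³)` and likewise
for `|d(T)|` (`knob_member_profile_sharp_headline`). THE CASES: at `w = k` the pin is
`|a(T)| ≥ 0.99655` and the cap is `ã² ≤ 1 - 0.99655² + 10⁻³ < 1/100` on `[0, T + 1/8]` for
EVERY lattice member of the window (`knob_lattice_dud_sharp` — parts 20/21/23's dud, now on
the whole window at `1/100`); at `w = k + ½` the pin is `|d(T)| ≥ 0.99655` and the member
fires `ã ≥ 3/4` from `T + 1/8` on (`knob_half_lattice_fire_sharp` — parts 22/23's tooth); in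
between, part 24's profile with its error `0.071` replaced by `0.07|co-ordinate| + 0.00345`.

HONEST LIMITS. (i) Second order in `ψ` along the circle, first order across it; the constants
`7/100`, `10⁻³` are part 21/23's budgets, not optimised. (ii) The cap holds on `[0, T + 1/8]`
only, the floor from `T + 1/8` on only; nothing in between, no second-pulse exclusion, no
statement about the ORDER of the dousing times across members. (iii) The floor is part 22a's
LINEAR drain bound. (iv) `M = K¹⁰` in §76 is Tao's choice of amplifier; §75 is general.
(v) Nothing about Navier–Stokes: a statement about the five-mode circuit (5.6).
[cite: Tao2016AveragedNS, §5.5 Theorem 5.3, (5.5), (5.6), (b-eq), (c-eq), (tcable)]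
-/

noncomputable section

namespace Summit.NavierStokesRegularity.FluidComputer.GateBudget

open Real Set Filter Topology
open Literature.Analysis.FluidPDE.Tao2016AveragedNS

variable {K M ε ρ : ℝ} {X : ℝ → Fin 5 → ℝ} {C : ℝ → ℝ}

/-! ## §75 The second-order profile, from the dynamics -/

/-- **THE PROFILE OF THE COMB TO SECOND ORDER — from the dynamics.** Along an exact trajectory
of `rotorCircuit K M ε ρ` from (5.6) with `0 < ρ² ≤ ε`, `Mρ⁴ ≤ ε²`, written `ε = wMρ²` (NO
lattice condition), under `16 ≤ K`, `48 log K ≤ M ≤ K¹⁰`, `ε² ≤ 1/(6K²⁰)` and with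
`(8/M)log(25εK¹⁰/(8ρ²)) + 200/(169M - 400) ≤ Δ < 1/16`: there are times `1 ≤ s₀ ≤ 3/2 < T`,
`T - s₀ ≤ Δ` (part 19) such that, for ANY `ψ ≥` the phase budget of part 22b
(`winding_psi_le`, `κ ≥ w`) and `D ≥` the drift of part 20 (`lattice_drift_le`, `P ≥ ρ²`):
(EXIT) `|cos wπ|(1 - ψ²/2) - |sin wπ|ψ - D ≤ |a(T)| ≤ |cos wπ| + |sin wπ|ψ + D` and
`|sin wπ|(1 - ψ²/2) - |cos wπ|ψ - D ≤ |d(T)| ≤ |sin wπ| + |cos wπ|ψ + D`;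
(CAP) for every pin `0 ≤ L ≤ |cos wπ|(1 - ψ²/2) - |sin wπ|ψ - D`, `ã(t)² ≤ 1 - L² + A` for all
`t ∈ [0, T + 1/8]`, `A = 16(K⁻¹⁰ + 4e^{-M}/M + ε)/M + 4e^{-M}/M`;
(FLOOR) for every pin `0 ≤ L ≤ |sin wπ|(1 - ψ²/2) - |cos wπ|ψ - D` and `θ ≥ 0` with
`θ ≤ (K/8)(L² - A′ - θ²)`, `A′ = 8(K⁻¹⁰ + 4e^{-M}/M)/M + e^{-M}/M`, `ã(t) ≥ θ` for all
`t ≥ T + 1/8`. Part 25a §73–§74 with the levels of part 19 (`β = ε/4`,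
`λ₀ = K⁻¹⁰ + 4e^{-M}/M`, `ϱ = 7ε/10`, `b₁ = ε/2`, `γ₁ = ρ²/K¹⁰`, `φ₀ = 3/(2K¹⁰)`). Part 24b's
`knob_member_profile` is its first-order shadow.
[cite: Tao2016AveragedNS, §5.5 Theorem 5.3, (5.5), (5.6), (b-eq), (c-eq), (tcable)] -/
theorem knob_member_profile_sharp
    (hX : ∀ t, HasDerivAt X (RotorKnob.rotorCircuit K M ε ρ (X t)) t)
    (h0 : X 0 = delayInit) (hε : 0 < ε) (hρ : 0 < ρ) (hρε : ρ ^ 2 ≤ ε)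
    (hMρ : M * ρ ^ 4 ≤ ε ^ 2) (hM : 0 < M) (hMK : M ≤ K ^ 10) (hK : 16 ≤ K)
    (hML : 48 * Real.log K ≤ M) (hεK : ε ^ 2 ≤ 1 / (6 * K ^ 20))
    (hC : ∀ t, HasDerivAt C (X t 2) t) (w : ℝ) (hk : ε = w * M * ρ ^ 2)
    {κ P Δ ψ D : ℝ} (hκ : w ≤ κ) (hP : ρ ^ 2 ≤ P)
    (hΔ : 8 * log (25 * ε * K ^ 10 / (8 * ρ ^ 2)) / M + 200 / (169 * M - 400) ≤ Δ)
    (hH : Δ < 1 / 16)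
    (hψ : 6 / (M * K ^ 10) + 16 * exp (-M) / M ^ 2
        + (κ * (π * (100 / (49 * M))) + 10 * exp (-M) * Δ / (7 * M)) / (1 - 100 / (49 * M))
        + 3 / (2 * K ^ 10) ≤ ψ)
    (hD : 6 * (ε + P * exp (-M) + 3 / K ^ 9)
        + 2 * (ε + P * exp (-M) + 3 / K ^ 9 + K ^ 2 * Δ) * Δ ≤ D) :
    ∃ s₀ T : ℝ, 1 ≤ s₀ ∧ s₀ ≤ 3 / 2 ∧ s₀ < T ∧ T - s₀ ≤ Δ ∧
      (|X T 0| ≤ |cos (w * π)| + |sin (w * π)| * ψ + D ∧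
        |X T 3| ≤ |sin (w * π)| + |cos (w * π)| * ψ + D ∧
        |cos (w * π)| * (1 - ψ ^ 2 / 2) - |sin (w * π)| * ψ - D ≤ |X T 0| ∧
        |sin (w * π)| * (1 - ψ ^ 2 / 2) - |cos (w * π)| * ψ - D ≤ |X T 3|) ∧
      (∀ L : ℝ, 0 ≤ L → L ≤ |cos (w * π)| * (1 - ψ ^ 2 / 2) - |sin (w * π)| * ψ - D →
        ∀ t ∈ Icc 0 (T + 1 / 8), X t 4 ^ 2 ≤ 1 - L ^ 2
          + (16 * (1 / K ^ 10 + 4 * exp (-M) / M + ε) / M + 4 * exp (-M) / M)) ∧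
      (∀ L : ℝ, 0 ≤ L → L ≤ |sin (w * π)| * (1 - ψ ^ 2 / 2) - |cos (w * π)| * ψ - D →
        ∀ θ : ℝ, 0 ≤ θ →
        θ ≤ K / 8 * (L ^ 2 - (8 * (1 / K ^ 10 + 4 * exp (-M) / M) / M + exp (-M) / M) - θ ^ 2) →
        ∀ t, T + 1 / 8 ≤ t → θ ≤ X t 4) := by
  have hK0 : 0 < K := by linarith
  have hK1 : 1 ≤ K := by linarith
  have hε2 : 0 < ε ^ 2 := by positivity
  -- the winding number is positive
  have hw' : w = ε / (M * ρ ^ 2) := by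
    rw [eq_div_iff (by positivity), hk]; ring
  have hw0 : 0 < w := by rw [hw']; positivity
  have hM133 : 133 ≤ M := by
    have h16 : log 16 = 4 * log 2 := by
      rw [show (16 : ℝ) = 2 ^ 4 by norm_num, Real.log_pow]; norm_num
    have hlogK : log 16 ≤ log K := log_le_log (by norm_num) hK
    linarith [Real.log_two_gt_d9]
  have hε1 : ε ≤ 1 := by
    have hK20 : (1700 : ℝ) ≤ K ^ 20 :=
      le_trans (by norm_num) (pow_le_pow_left₀ (by norm_num) hK 20)
    have h1 : ε ^ 2 ≤ 1 := by
      refine hεK.trans ?_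
      rw [div_le_one (by positivity)]; linarith
    nlinarith
  -- part 19: the levels at the member's critical time `s₀` and dousing time `T`
  obtain ⟨s₀, T, hs1, hs32, hsT, hTΔ, hcpos, harm, hbs, hcs, hbT, hcT, hΦ, ha₀, haT, -, -⟩ :=
    knob_dynamic_levels hX h0 hε hρ hρε hM hMK hK hML hεK hMρ hC (lt_of_le_of_lt hΔ hH)
  have hTΔ' : T - s₀ ≤ Δ := hTΔ.trans hΔ
  have hs0 : 0 ≤ s₀ := by linarith
  have hT0 : 0 ≤ T := by linarith
  -- the critical ratio is subunit on the window radius `ϱ = 7ε/10`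
  have hq : ε ^ 2 < M * (7 / 10 * ε) ^ 2 := by
    have hMε : 133 * ε ^ 2 ≤ M * ε ^ 2 := mul_le_mul_of_nonneg_right hM133 hε2.le
    have h49 : M * (7 / 10 * ε) ^ 2 = 49 / 100 * (M * ε ^ 2) := by ring
    rw [h49]; linarith
  -- the self-timed window `β/(2ε) = 1/8` and the afterglows at `β = ε/4`
  have h8 : ε / 4 / (2 * ε) = 1 / 8 := by
    field_simp; ring
  have hA : 2 * ε * (1 / K ^ 10 + 4 * exp (-M) / M) / (M * (ε / 4))
      = 8 * (1 / K ^ 10 + 4 * exp (-M) / M) / M := by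
    field_simp; ring
  have hA2 : 4 * ε * (1 / K ^ 10 + 4 * exp (-M) / M + ε) / (M * (ε / 4))
      = 16 * (1 / K ^ 10 + 4 * exp (-M) / M + ε) / M := by
    field_simp; ring
  -- the closed forms of the phase budget (part 22b) and of the drift (part 20)
  have hψ' := (winding_psi_le w hw0.le hk hκ hε hρ hM133 hK0 hTΔ').trans hψ
  have hD' := (lattice_drift_le hK1 hε.le hP hs0 hs32 (by linarith) hTΔ' ha₀ haT).trans hD
  -- part 24a §69: the total phase is `wπ` up to the budget; part 25a §73: the sharp exit
  have hη := knob_swing_lower (b₁ := ε / 2) (γ₁ := ρ ^ 2 / K ^ 10) (β := ε / 4)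
    (lam₀ := 1 / K ^ 10 + 4 * exp (-M) / M) (by positivity) hbs (hcpos s₀ ⟨le_rfl, hsT.le⟩)
    hcs.le (by positivity) hbT (hcpos T ⟨hsT.le, le_rfl⟩) hcT
  have hph := knob_winding_phase hX h0 hε hρ hM hC w hw0.le hk hsT.le (by positivity) hq hcpos
    harm hη hΦ
  obtain ⟨⟨hd1, hd2⟩, ha1, ha2⟩ :=
    knob_phase_exit_sharp hX h0 hC hε.le hK0.le hs0 hsT.le (hph.trans hψ')
  have hψ0 : 0 ≤ ψ := (abs_nonneg _).trans (hph.trans hψ')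
  have hsψ : 0 ≤ |sin (w * π)| * ψ := mul_nonneg (abs_nonneg _) hψ0
  have hcψ : 0 ≤ |cos (w * π)| * ψ := mul_nonneg (abs_nonneg _) hψ0
  refine ⟨s₀, T, hs1, hs32, hsT, hTΔ', ⟨by linarith, by linarith, by linarith, by linarith⟩,
    fun L hL hLa t ht => ?_, fun L hL hLd θ hθ hfire t ht => ?_⟩
  · -- part 25a §74: the cap behind the pin `L ≤ |a(T)|`
    have ht' : t ∈ Icc 0 (T + ε / 4 / (2 * ε)) := by rw [h8]; exact ht
    have hcap := knob_member_cap_of_pin hX h0 hε hε1 hρ hρε hM hK0.le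
      (lam₀ := 1 / K ^ 10 + 4 * exp (-M) / M) hT0 (by positivity) hbT hcT hL
      (hLa.trans (by linarith)) ht'
    rw [hA2] at hcap
    exact hcap
  · -- part 25a §74: the floor behind the pin `L ≤ |d(T)|`
    have hfire' : θ ≤ K * (L ^ 2
        - (2 * ε * (1 / K ^ 10 + 4 * exp (-M) / M) / (M * (ε / 4)) + exp (-M) / M) - θ ^ 2)
          * (ε / 4 / (2 * ε)) := by
      rw [hA, h8]; linarith
    have hfired := knob_member_fire_of_pin hX h0 hε hρ hM hK0.le
      (lam₀ := 1 / K ^ 10 + 4 * exp (-M) / M) hT0 (by positivity) hbT hcT hL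
      (hLd.trans (by linarith)) hθ hfire'
    rw [h8] at hfired
    exact hfired t ht

/-! ## §76 The second-order profile at Tao's amplifier `M = K¹⁰`, and its cases -/

/-- **THE PROFILE OF THE COMB TO SECOND ORDER AT `M = K¹⁰`.** For `K ≥ 16`, `0 < ε`,
`ε² ≤ 1/(6K²⁰)` and an exact trajectory of `rotorCircuit K K¹⁰ ε ρ` from (5.6) with
`200ε/K²⁰ ≤ ρ² ≤ 2ε/K¹⁰` (winding number `w = ε/(K¹⁰ρ²)` between `1/2` and `K¹⁰/200`, no
lattice condition) there are times `1 ≤ s₀ ≤ 3/2 < T ≤ s₀ + 242/K⁹` (its own) such that,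
with `c = |cos wπ|`, `s = |sin wπ|`: (EXIT) `0.99755c - 0.07s - 10⁻³ ≤ |a(T)| ≤ c + 0.07s + 10⁻³`
and `0.99755s - 0.07c - 10⁻³ ≤ |d(T)| ≤ s + 0.07c + 10⁻³`; (CAP) for every pin
`0 ≤ L ≤ 0.99755c - 0.07s - 10⁻³`, `ã(t)² ≤ 1 - L² + 10⁻³` on `[0, T + 1/8]`; (FLOOR) for every
pin `0 ≤ L ≤ 0.99755s - 0.07c - 10⁻³` and `θ ≥ 0` with `θ ≤ (K/8)(L² - 10⁻³ - θ²)`, `ã(t) ≥ θ`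
for `t ≥ T + 1/8` — §75 at `M = K¹⁰`, `Δ = 242/K⁹`, `ψ = 7/100` (`1 - ψ²/2 = 19951/20000`),
`D = 10⁻³`, the largeness hypotheses discharged by parts 21/23 (`headline_trigger`,
`headline_drift`, `headline_afterglow`, `teeth_psi`, `teeth_afterglow`) and `profile_delta`.
Part 24b's headline is the case "first order" (`0.071` flat); the lattice cases follow.
[cite: Tao2016AveragedNS, §5.5 Theorem 5.3, (5.5), (5.6), (b-eq), (c-eq), (tcable)] -/
theorem knob_member_profile_sharp_headline {K ε ρ : ℝ} {X : ℝ → Fin 5 → ℝ} {C : ℝ → ℝ}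
    (hX : ∀ t, HasDerivAt X (RotorKnob.rotorCircuit K (K ^ 10) ε ρ (X t)) t)
    (h0 : X 0 = delayInit) (hC : ∀ t, HasDerivAt C (X t 2) t) (hK : 16 ≤ K) (hε : 0 < ε)
    (hεK : ε ^ 2 ≤ 1 / (6 * K ^ 20)) (hρ : 0 < ρ) (hlo : 200 * ε / K ^ 20 ≤ ρ ^ 2)
    (hhi : K ^ 10 * ρ ^ 2 ≤ 2 * ε) :
    ∃ s₀ T : ℝ, 1 ≤ s₀ ∧ s₀ ≤ 3 / 2 ∧ s₀ < T ∧ T - s₀ ≤ 242 / K ^ 9 ∧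
      (|X T 0| ≤ |cos (ε / (K ^ 10 * ρ ^ 2) * π)|
          + 7 / 100 * |sin (ε / (K ^ 10 * ρ ^ 2) * π)| + 1 / 1000 ∧
        |X T 3| ≤ |sin (ε / (K ^ 10 * ρ ^ 2) * π)|
          + 7 / 100 * |cos (ε / (K ^ 10 * ρ ^ 2) * π)| + 1 / 1000 ∧
        19951 / 20000 * |cos (ε / (K ^ 10 * ρ ^ 2) * π)|
          - 7 / 100 * |sin (ε / (K ^ 10 * ρ ^ 2) * π)| - 1 / 1000 ≤ |X T 0| ∧
        19951 / 20000 * |sin (ε / (K ^ 10 * ρ ^ 2) * π)|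
          - 7 / 100 * |cos (ε / (K ^ 10 * ρ ^ 2) * π)| - 1 / 1000 ≤ |X T 3|) ∧
      (∀ L : ℝ, 0 ≤ L → L ≤ 19951 / 20000 * |cos (ε / (K ^ 10 * ρ ^ 2) * π)|
          - 7 / 100 * |sin (ε / (K ^ 10 * ρ ^ 2) * π)| - 1 / 1000 →
        ∀ t ∈ Icc 0 (T + 1 / 8), X t 4 ^ 2 ≤ 1 - L ^ 2 + 1 / 1000) ∧
      (∀ L : ℝ, 0 ≤ L → L ≤ 19951 / 20000 * |sin (ε / (K ^ 10 * ρ ^ 2) * π)|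
          - 7 / 100 * |cos (ε / (K ^ 10 * ρ ^ 2) * π)| - 1 / 1000 →
        ∀ θ : ℝ, 0 ≤ θ → θ ≤ K / 8 * (L ^ 2 - 1 / 1000 - θ ^ 2) →
        ∀ t, T + 1 / 8 ≤ t → θ ≤ X t 4) := by
  have hK0 : 0 < K := by linarith
  have hK10 : 0 < K ^ 10 := by positivity
  have h10 : (1024 : ℝ) ≤ K ^ 10 := le_trans (by norm_num) (pow_le_pow_left₀ (by norm_num) hK 10)
  have h9 : (68719476736 : ℝ) ≤ K ^ 9 := by
    have := headline_pow_floor hK 9; norm_num at this; exact this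
  have hH : (242 : ℝ) / K ^ 9 < 1 / 16 := by
    rw [div_lt_div_iff₀ (by positivity) (by norm_num)]; linarith [h9]
  have hΔ0 : (0 : ℝ) ≤ 242 / K ^ 9 := by positivity
  -- the member's winding number `w = ε/(K¹⁰ρ²) ≤ κ := 2w`, and `20ε/K²⁰ ≤ 200ε/K²⁰ ≤ ρ²`
  have hk : ε = ε / (K ^ 10 * ρ ^ 2) * K ^ 10 * ρ ^ 2 := by
    field_simp
  have hκ : ε / (K ^ 10 * ρ ^ 2) ≤ 2 * ε / (K ^ 10 * ρ ^ 2) :=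
    div_le_div_of_nonneg_right (by linarith) (by positivity)
  have hlo20 : 20 * ε / K ^ 20 ≤ ρ ^ 2 :=
    le_trans (div_le_div_of_nonneg_right (by linarith) (by positivity)) hlo
  -- `ρ² ≤ 2ε/K¹⁰ ≤ ε` and `K¹⁰ρ⁴ ≤ 2ερ² ≤ 4ε²/K¹⁰ ≤ ε²`
  have hρε : ρ ^ 2 ≤ ε := by nlinarith [sq_nonneg ρ]
  have hMρ : K ^ 10 * ρ ^ 4 ≤ ε ^ 2 := by
    have h1 : K ^ 10 * ρ ^ 4 = (K ^ 10 * ρ ^ 2) * ρ ^ 2 := by ring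
    have h2 : K ^ 10 * ρ ^ 4 ≤ 2 * ε * ρ ^ 2 := by
      rw [h1]; exact mul_le_mul_of_nonneg_right hhi (sq_nonneg ρ)
    have h3 : K ^ 10 * (2 * ε * ρ ^ 2) ≤ 2 * ε * (2 * ε) := by nlinarith
    nlinarith
  -- the numerics of parts 21 and 23: `ψ = 7/100`, `D = 10⁻³`, `A, A′ ≤ 10⁻³`
  have hψ := teeth_psi hK hε hlo hΔ0 (by linarith : (242 : ℝ) / K ^ 9 ≤ 1)
  have hD := headline_drift hK hεK hhi
  have hAd := headline_afterglow hK hεK (ε := ε)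
  have hAf := teeth_afterglow hK
  obtain ⟨s₀, T, hs1, hs2, hsT, hTs, ⟨ha1, hd1, ha2, hd2⟩, hcap, hfire⟩ :=
    knob_member_profile_sharp hX h0 hε hρ hρε hMρ hK10 le_rfl hK (headline_trigger hK) hεK hC
      (ε / (K ^ 10 * ρ ^ 2)) hk (P := ρ ^ 2) hκ le_rfl (profile_delta hK hε hρ hlo20) hH hψ hD
  have e2 : (1 - (7 / 100 : ℝ) ^ 2 / 2) = 19951 / 20000 := by norm_num
  rw [e2] at ha2 hd2 hcap hfire
  refine ⟨s₀, T, hs1, hs2, hsT, hTs, ⟨by linarith, by linarith, by linarith, by linarith⟩,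
    fun L hL hLa t ht => ?_, fun L hL hLd θ hθ hθK t ht => ?_⟩
  · have h := hcap L hL (by linarith) t ht
    linarith
  · refine hfire L hL (by linarith) θ hθ ?_ t ht
    have hK8 : 0 ≤ K / 8 := by positivity
    have hmono : K / 8 * (L ^ 2 - 1 / 1000 - θ ^ 2) ≤ K / 8 * (L ^ 2
        - (8 * (1 / K ^ 10 + 4 * exp (-K ^ 10) / K ^ 10) / K ^ 10 + exp (-K ^ 10) / K ^ 10)
        - θ ^ 2) :=
      mul_le_mul_of_nonneg_left (by linarith) hK8
    exact hθK.trans hmono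

/-- **THE CASE `w = k`: EVERY LATTICE MEMBER OF THE WINDOW IS A DUD AT `1/100`.** Under the
hypotheses of `knob_member_profile_sharp_headline`, if `ε = k·K¹⁰ρ²` (`k ∈ ℕ`: the winding
number sits ON the lattice, `σ_knob·K¹⁰ = 1/k`), then at the member's dousing time
`|a(T)| ≥ 0.99655`, `|d(T)| ≤ 0.071`, and `ã(t)² ≤ 1/100` for EVERY `t ∈ [0, T + 1/8]`
(`sin kπ = 0`, `|cos kπ| = 1`, the pin `L = 19931/20000`). Parts 20/21's dud (`ψ = 3/4`, cap
`1/2` on `[20ε/K²⁰, 2ε/K¹⁰]`) and part 23's (`1/100` on `[ε/K¹⁰, 2ε/K¹⁰]`) as one case of §76.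
[cite: Tao2016AveragedNS, §5.5 Theorem 5.3, (5.5), (5.6), (energy-con)] -/
theorem knob_lattice_dud_sharp {K ε ρ : ℝ} {X : ℝ → Fin 5 → ℝ} {C : ℝ → ℝ}
    (hX : ∀ t, HasDerivAt X (RotorKnob.rotorCircuit K (K ^ 10) ε ρ (X t)) t)
    (h0 : X 0 = delayInit) (hC : ∀ t, HasDerivAt C (X t 2) t) (hK : 16 ≤ K) (hε : 0 < ε)
    (hεK : ε ^ 2 ≤ 1 / (6 * K ^ 20)) (hρ : 0 < ρ) (hlo : 200 * ε / K ^ 20 ≤ ρ ^ 2)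
    (hhi : K ^ 10 * ρ ^ 2 ≤ 2 * ε) (k : ℕ) (hk : ε = k * K ^ 10 * ρ ^ 2) :
    ∃ s₀ T : ℝ, 1 ≤ s₀ ∧ s₀ ≤ 3 / 2 ∧ s₀ < T ∧ T - s₀ ≤ 242 / K ^ 9 ∧
      19931 / 20000 ≤ |X T 0| ∧ |X T 3| ≤ 71 / 1000 ∧
      ∀ t ∈ Icc 0 (T + 1 / 8), X t 4 ^ 2 ≤ 1 / 100 := by
  have hK0 : 0 < K := by linarith
  obtain ⟨s₀, T, hs1, hs2, hsT, hTs, ⟨-, hd1, ha2, -⟩, hcap, -⟩ :=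
    knob_member_profile_sharp_headline hX h0 hC hK hε hεK hρ hlo hhi
  -- on the lattice `w = k`: `sin kπ = 0`, `|cos kπ| = 1`
  have hw : ε / (K ^ 10 * ρ ^ 2) = k := by
    rw [div_eq_iff (by positivity), hk]; ring
  have hs : |sin (ε / (K ^ 10 * ρ ^ 2) * π)| = 0 := by
    rw [hw, Real.sin_nat_mul_pi, abs_zero]
  have hc : |cos (ε / (K ^ 10 * ρ ^ 2) * π)| = 1 := by
    rw [hw]; exact_mod_cast Real.abs_cos_int_mul_pi k
  rw [hs, hc] at hd1 ha2 hcap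
  refine ⟨s₀, T, hs1, hs2, hsT, hTs, by linarith, by linarith, fun t ht => ?_⟩
  have h := hcap (19931 / 20000) (by norm_num) (by norm_num) t ht
  have hn : (1 : ℝ) - (19931 / 20000) ^ 2 + 1 / 1000 ≤ 1 / 100 := by norm_num
  exact h.trans hn

/-- **THE CASE `w = k + ½`: EVERY HALF-LATTICE MEMBER OF THE WINDOW FIRES AT `3/4`.** Under the
hypotheses of `knob_member_profile_sharp_headline`, if `2ε = (2k + 1)·K¹⁰ρ²` (`k ∈ ℕ`: the
winding number sits HALF-WAY between lattice points), then at the member's dousing time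
`|d(T)| ≥ 0.99655`, `|a(T)| ≤ 0.071`, and `ã(t) ≥ 3/4` for EVERY `t ≥ T + 1/8`
(`|sin (k + ½)π| = 1`, `cos (k + ½)π = 0`, the pin `L = 19931/20000`, and
`3/4 ≤ (K/8)(0.99655² - 10⁻³ - 9/16)` for `K ≥ 16`). Parts 22/23's tooth as one case of §76.
[cite: Tao2016AveragedNS, §5.5 Theorem 5.3, (b-eq), (c-eq), (tcable)] -/
theorem knob_half_lattice_fire_sharp {K ε ρ : ℝ} {X : ℝ → Fin 5 → ℝ} {C : ℝ → ℝ}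
    (hX : ∀ t, HasDerivAt X (RotorKnob.rotorCircuit K (K ^ 10) ε ρ (X t)) t)
    (h0 : X 0 = delayInit) (hC : ∀ t, HasDerivAt C (X t 2) t) (hK : 16 ≤ K) (hε : 0 < ε)
    (hεK : ε ^ 2 ≤ 1 / (6 * K ^ 20)) (hρ : 0 < ρ) (hlo : 200 * ε / K ^ 20 ≤ ρ ^ 2)
    (hhi : K ^ 10 * ρ ^ 2 ≤ 2 * ε) (k : ℕ) (hk : 2 * ε = (2 * k + 1) * K ^ 10 * ρ ^ 2) :
    ∃ s₀ T : ℝ, 1 ≤ s₀ ∧ s₀ ≤ 3 / 2 ∧ s₀ < T ∧ T - s₀ ≤ 242 / K ^ 9 ∧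
      19931 / 20000 ≤ |X T 3| ∧ |X T 0| ≤ 71 / 1000 ∧
      ∀ t, T + 1 / 8 ≤ t → 3 / 4 ≤ X t 4 := by
  have hK0 : 0 < K := by linarith
  obtain ⟨s₀, T, hs1, hs2, hsT, hTs, ⟨ha1, -, -, hd2⟩, -, hfire⟩ :=
    knob_member_profile_sharp_headline hX h0 hC hK hε hεK hρ hlo hhi
  -- half-way between lattice points `wπ = kπ + π/2`: `|sin| = 1`, `cos = 0`
  have hw : ε / (K ^ 10 * ρ ^ 2) * π = k * π + π / 2 := by
    have : ε / (K ^ 10 * ρ ^ 2) = k + 1 / 2 := by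
      rw [div_eq_iff (by positivity)]; linarith
    rw [this]; ring
  have hs : |sin (ε / (K ^ 10 * ρ ^ 2) * π)| = 1 := by
    rw [hw, Real.sin_add_pi_div_two]; exact_mod_cast Real.abs_cos_int_mul_pi k
  have hc : |cos (ε / (K ^ 10 * ρ ^ 2) * π)| = 0 := by
    rw [hw, Real.cos_add_pi_div_two, abs_neg, Real.sin_nat_mul_pi, abs_zero]
  rw [hs, hc] at ha1 hd2 hfire
  refine ⟨s₀, T, hs1, hs2, hsT, hTs, by linarith, by linarith, fun t ht => ?_⟩
  refine hfire (19931 / 20000) (by norm_num) (by norm_num) (3 / 4) (by norm_num) ?_ t ht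
  nlinarith

end Summit.NavierStokesRegularity.FluidComputer.GateBudget
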